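import Literature.Analysis.FluidPDE.TransportWeakExistenceProofs
import Literature.Analysis.FluidPDE.AcceleratingDissipationEnhancement
import HarnessLib

/-!
# Mild (Duhamel) formulation of the passive scalar equation with constant diagonal diffusion and
  bounded drift, I: the Fourier-side objects and their measurability

Analysis/FluidPDE proof-support file (everything proved), first of the files constructing, for
`κ > 0`, coefficients `a : d → ℝ` with `aᵢ > 0`, a bounded measurable drift `u` on `(0,T) × T^d`
and an `L²` datum `θ₀`, a weak solution of

  `∂ₜθ + div (u θ) = κ ∑ᵢ aᵢ ∂ᵢ∂ᵢθ`,  `θ(0) = θ₀`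

(`Torus.IsWeakScalarTransportDiagOn`, the class of Hess-Childs–Rowan's flat torus
`[0,√2]×[0,1]` written on the unit torus, `AcceleratingDissipationEnhancement`) which is moreover
the STRONGLY `L²`-continuous representative (`Torus.IsL2ContinuousOn`). The construction is the
classical one of **mild solutions**: writing `ĉ(t) = 𝓕(θ(t))`, `νₖ = 4π²κ ∑ᵢ aᵢ kᵢ²`
(`Torus.diagRate`) and `N(θ)(s)(k) = 𝓕(div(u(s)θ(s)))(k) = ∑ⱼ 2πi kⱼ 𝓕(uⱼ(s)θ(s))(k)`
(`Torus.transportCoeff`), the equation is the fixed-point problem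

  `ĉₖ(t) = e^{-νₖt} θ̂₀(k) - ∫₀ᵗ e^{-νₖ(t-s)} N(θ)(s)(k) ds`

(Duhamel's formula mode by mode; Pazy 1983, Ch. 4 §4.2, Def. 2.3 / Cor. 2.5; Evans 2010, §7.1.2–
7.1.3 for the Fourier construction of parabolic solutions). The transport term loses one derivative
and the heat factor regains exactly one half in `L²` in time:
`|∫₀ᵗ e^{-(νₖ+λ)(t-s)} Nₖ| ² ≤ (4π²Qₐ(k)/(2νₖ+λ)) ∫₀ᵗ e^{-λ(t-s)} ∑ⱼ aⱼ⁻¹|𝓕(uⱼθ)(k)|²`, and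
`4π²Qₐ(k)/(2νₖ) = 1/(2κ)`, so that summing over `k` (Bessel) the Duhamel term is bounded in
`L^∞_t ℓ²` by `(∑ⱼaⱼ⁻¹)‖u‖²_∞/(2κλ) · sup_s ‖θ(s)‖²_{L²}` — a contraction after an exponential time
weight `λ` (sequel files `PassiveScalarDiagMildTransport`, `…MildBounds`, `…MildTails`,
`…MildFixedPoint`, `…MildWeak`, `PassiveScalarDiagExistence`).

This file: the definitions (`diagFreqSq`, `diagRate`, `transportCoeff`, `duhamelCoeff`,
`mildMap`) and the standing hypotheses (`Torus.DriftBound` — a drift bounded by `U` a.e. on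
`(0,T) × T^d`, obtained from `u ∈ L^∞` of the space–time lift; `Torus.IsL2Field` — a jointly
measurable field with `θ(t) ∈ L²`, `∫ θ(t)² ≤ E` at EVERY `t ∈ [0,T]`) with their bookkeeping.

## Mathlib / tree search

Mathlib (this pin) has no semigroup / mild-solution theory for evolution equations (searched
`mild`, `Duhamel`, `C0Semigroup`); the Fourier side is Mathlib's `UnitAddTorus.mFourierCoeff`
through the tree's `Literature.Analysis.FunctionSpaces.Torus*` layer (Parseval
`hasSum_conj_mul_mFourierCoeff`, parametrised Riesz–Fischer
`Torus.exists_realScalarField_forall_mFourierCoeff_eq`). The tree's `ScalarFourierPicard` solves the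
same mild system for SMOOTH data in weighted `ℓ¹` (classical solutions); here the data are rough
(`u ∈ L^∞`, `θ₀ ∈ L²`) and the estimates are `ℓ²`/Parseval ones.

## References

* A. Pazy, *Semigroups of Linear Operators and Applications to Partial Differential Equations*,
  Springer 1983, Ch. 4 §4.2 (mild solutions, Duhamel's formula).
* L. C. Evans, *Partial Differential Equations*, 2nd ed. (AMS 2010), §7.1.2–7.1.3.
* R. J. DiPerna, P.-L. Lions, Invent. Math. 98 (1989) 511–547, §II.1 (the weak class).
* L. Grafakos, *Classical Fourier Analysis*, 3rd ed. (2014), Prop. 3.2.6 (4), (8), Prop. 3.2.7 (3).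
-/

noncomputable section

open MeasureTheory TopologicalSpace Set Function Filter UnitAddTorus
open _root_.Topology
open scoped ENNReal NNReal InnerProductSpace ComplexConjugate

namespace Literature.Analysis.FluidPDE

namespace Torus

open Literature.Analysis.FunctionSpaces.Torus Literature.Analysis.FunctionSpaces

variable {d : Type*} [Fintype d]

/-! ## The diagonal symbol and the heat rate -/

section Symbol

/-- The **diagonal frequency weight** `Qₐ(k) = ∑ᵢ aᵢ kᵢ²` of the operator `-∑ᵢ aᵢ ∂ᵢ∂ᵢ` on
`T^d` (`𝓕(∑ᵢ aᵢ∂ᵢ∂ᵢφ)(k) = -4π² Qₐ(k) φ̂(k)`); `Q₁ = |k|²` (`Torus.freqNormSq`). [cite: Grafakos2014, Prop. 3.2.6 (8)] -/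
def diagFreqSq (a : d → ℝ) (k : d → ℤ) : ℝ := ∑ i, a i * (k i : ℝ) ^ 2

/-- Unfolding `diagFreqSq`. [cite: Grafakos2014, Prop. 3.2.6 (8)] -/
theorem diagFreqSq_apply (a : d → ℝ) (k : d → ℤ) : diagFreqSq a k = ∑ i, a i * (k i : ℝ) ^ 2 := rfl

/-- `Qₐ(k) ≥ 0` for nonnegative coefficients. [cite: Grafakos2014, Prop. 3.2.6 (8)] -/
theorem diagFreqSq_nonneg {a : d → ℝ} (ha : ∀ i, 0 ≤ a i) (k : d → ℤ) : 0 ≤ diagFreqSq a k :=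
  Finset.sum_nonneg fun i _ => mul_nonneg (ha i) (sq_nonneg _)

/-- `Qₐ(-k) = Qₐ(k)`. [cite: Grafakos2014, Prop. 3.2.6 (8)] -/
theorem diagFreqSq_neg (a : d → ℝ) (k : d → ℤ) : diagFreqSq a (-k) = diagFreqSq a k := by
  simp only [diagFreqSq, Pi.neg_apply, Int.cast_neg, neg_sq]

/-- With all coefficients `1`, `Qₐ = |k|²`. [cite: Grafakos2014, Prop. 3.2.6 (8)] -/
theorem diagFreqSq_one (k : d → ℤ) : diagFreqSq (fun _ : d => (1 : ℝ)) k = freqNormSq k := by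
  simp only [diagFreqSq, one_mul, freqNormSq]

/-- The **diagonal heat rate** `νₖ = 4π²κ Qₐ(k) = 4π²κ ∑ᵢ aᵢkᵢ²`: the decay rate of the `k`-th
Fourier mode under `∂ₜ = κ ∑ᵢ aᵢ ∂ᵢ∂ᵢ` (`e_k ↦ e^{-νₖt} e_k`). [cite: Pazy1983, Ch. 4 §4.2, (2.3) and Def. 2.3 (mild solution), p. 106] -/
def diagRate (κ : ℝ) (a : d → ℝ) (k : d → ℤ) : ℝ := 4 * Real.pi ^ 2 * κ * diagFreqSq a k

/-- Unfolding `diagRate`. [cite: Grafakos2014, Prop. 3.2.6 (8)] -/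
theorem diagRate_apply (κ : ℝ) (a : d → ℝ) (k : d → ℤ) :
    diagRate κ a k = 4 * Real.pi ^ 2 * κ * diagFreqSq a k := rfl

/-- `νₖ ≥ 0` for `κ ≥ 0` and nonnegative coefficients. [cite: Grafakos2014, Prop. 3.2.6 (8)] -/
theorem diagRate_nonneg {κ : ℝ} (hκ : 0 ≤ κ) {a : d → ℝ} (ha : ∀ i, 0 ≤ a i) (k : d → ℤ) :
    0 ≤ diagRate κ a k := by
  rw [diagRate_apply]
  have := diagFreqSq_nonneg ha k
  positivity

/-- `ν₋ₖ = νₖ`. [cite: Grafakos2014, Prop. 3.2.6 (8)] -/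
theorem diagRate_neg (κ : ℝ) (a : d → ℝ) (k : d → ℤ) : diagRate κ a (-k) = diagRate κ a k := by
  rw [diagRate_apply, diagRate_apply, diagFreqSq_neg]

end Symbol

/-! ## The transport coefficient, the Duhamel integral, the Picard map -/

section Defs

/-- The **transport coefficient** of a scalar field `θ` carried by the drift `u` at time `s`:
`N(θ)(s)(k) = ∑ⱼ 2πi kⱼ · 𝓕(uⱼ(s) θ(s))(k)`, i.e. the `k`-th Fourier coefficient of
`div (u(s) θ(s))` read distributionally (`𝓕(∂ⱼ g)(k) = 2πi kⱼ ĝ(k)`, Grafakos 2014,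
Prop. 3.2.6 (8)); for divergence-free `u` this is `𝓕(u·∇θ)(k)`. Only `uⱼθ ∈ L¹` is needed for
the coefficients to be honest integrals. [cite: Grafakos2014, Prop. 3.2.6 (8)] -/
def transportCoeff (u : ℝ → UnitAddTorus d → EuclideanSpace ℝ d) (θ : ℝ → UnitAddTorus d → ℝ)
    (s : ℝ) (k : d → ℤ) : ℂ :=
  ∑ j, (2 * Real.pi * Complex.I * (k j : ℂ)) *
    mFourierCoeff (fun x => ((u s x j * θ s x : ℝ) : ℂ)) k

/-- Unfolding `transportCoeff`. [cite: Grafakos2014, Prop. 3.2.6 (8)] -/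
theorem transportCoeff_apply (u : ℝ → UnitAddTorus d → EuclideanSpace ℝ d)
    (θ : ℝ → UnitAddTorus d → ℝ) (s : ℝ) (k : d → ℤ) :
    transportCoeff u θ s k = ∑ j, (2 * Real.pi * Complex.I * (k j : ℂ)) *
      mFourierCoeff (fun x => ((u s x j * θ s x : ℝ) : ℂ)) k := rfl

/-- The (exponentially damped) **Duhamel coefficient**
`D^λ(θ)(t)(k) = ∫_{(0,t]} e^{-(νₖ+λ)(t-s)} N(θ)(s)(k) ds` — the `k`-th Fourier mode of
`∫₀ᵗ e^{(t-s)(κ∑aᵢ∂ᵢ∂ᵢ - λ)} div(u(s)θ(s)) ds` (Pazy 1983, Ch. 4, (2.3)); `λ = 0` is the undamped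
Duhamel integral, `λ > 0` corresponds to the substitution `θ = e^{λt} w`. [cite: Pazy1983, Ch. 4 §4.2, (2.3) and Def. 2.3 (mild solution), p. 106] -/
def duhamelCoeff (κ : ℝ) (a : d → ℝ) (lam : ℝ) (u : ℝ → UnitAddTorus d → EuclideanSpace ℝ d)
    (θ : ℝ → UnitAddTorus d → ℝ) (t : ℝ) (k : d → ℤ) : ℂ :=
  ∫ s in Ioc 0 t, ((Real.exp (-((diagRate κ a k + lam) * (t - s))) : ℝ) : ℂ) * transportCoeff u θ s k

/-- Unfolding `duhamelCoeff`. [cite: Pazy1983, Ch. 4 §4.2, (2.3) and Def. 2.3 (mild solution), p. 106] -/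
theorem duhamelCoeff_apply (κ : ℝ) (a : d → ℝ) (lam : ℝ) (u : ℝ → UnitAddTorus d → EuclideanSpace ℝ d)
    (θ : ℝ → UnitAddTorus d → ℝ) (t : ℝ) (k : d → ℤ) :
    duhamelCoeff κ a lam u θ t k = ∫ s in Ioc 0 t,
      ((Real.exp (-((diagRate κ a k + lam) * (t - s))) : ℝ) : ℂ) * transportCoeff u θ s k := rfl

/-- The **Picard (mild-solution) map** on the Fourier side:
`Φ(θ)(t)(k) = e^{-(νₖ+λ)t} θ̂₀(k) - D^λ(θ)(t)(k)` — the Fourier coefficients of the damped heat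
flow of the datum minus the damped Duhamel integral of `div(uθ)`; a fixed point
`𝓕(w(t)) = Φ(w)(t)` is a mild solution of `∂ₜw + λw + div(uw) = κ∑ᵢaᵢ∂ᵢ∂ᵢw`, `w(0) = θ₀`
(Pazy 1983, Ch. 4 Def. 2.3). [cite: Pazy1983, Ch. 4 §4.2, (2.3) and Def. 2.3 (mild solution), p. 106] -/
def mildMap (κ : ℝ) (a : d → ℝ) (lam : ℝ) (u : ℝ → UnitAddTorus d → EuclideanSpace ℝ d)
    (θ₀ : UnitAddTorus d → ℝ) (θ : ℝ → UnitAddTorus d → ℝ) (t : ℝ) (k : d → ℤ) : ℂ :=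
  ((Real.exp (-((diagRate κ a k + lam) * t)) : ℝ) : ℂ) * mFourierCoeff (fun x => (θ₀ x : ℂ)) k -
    duhamelCoeff κ a lam u θ t k

/-- Unfolding `mildMap`. [cite: Pazy1983, Ch. 4 §4.2, (2.3) and Def. 2.3 (mild solution), p. 106] -/
theorem mildMap_apply (κ : ℝ) (a : d → ℝ) (lam : ℝ) (u : ℝ → UnitAddTorus d → EuclideanSpace ℝ d)
    (θ₀ : UnitAddTorus d → ℝ) (θ : ℝ → UnitAddTorus d → ℝ) (t : ℝ) (k : d → ℤ) :
    mildMap κ a lam u θ₀ θ t k =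
      ((Real.exp (-((diagRate κ a k + lam) * t)) : ℝ) : ℂ) * mFourierCoeff (fun x => (θ₀ x : ℂ)) k -
        duhamelCoeff κ a lam u θ t k := rfl

end Defs

/-! ## Standing hypotheses: a bounded measurable drift, an `L^∞_t L²_x` field defined at every time -/

section Hypotheses

/-- **A bounded measurable drift on `(0,T) × T^d`** with the bound `U`: `u` is a.e. strongly
measurable for the product measure and `‖u(t,x)‖ ≤ U` a.e. — the content of
`u ∈ L^∞((0,T) × T^d)` (`DriftBound.of_memLp_top`), recorded with an explicit constant. [cite: DiPernaLions1989, §II.1 (12)–(14)] -/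
structure DriftBound (T : ℝ) (u : ℝ → UnitAddTorus d → EuclideanSpace ℝ d) (U : ℝ) : Prop where
  /-- `0 ≤ U`. -/
  nonneg : 0 ≤ U
  /-- Joint measurability on `(0,T) × T^d`. -/
  aestronglyMeasurable :
    AEStronglyMeasurable (uncurry u) (((volume : Measure ℝ).restrict (Ioo 0 T)).prod volume)
  /-- `‖u‖ ≤ U` a.e. on `(0,T) × T^d`. -/
  ae_norm_le : ∀ᵐ p ∂(((volume : Measure ℝ).restrict (Ioo 0 T)).prod
    (volume : Measure (UnitAddTorus d))), ‖u p.1 p.2‖ ≤ U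

namespace DriftBound

variable {T U : ℝ} {u : ℝ → UnitAddTorus d → EuclideanSpace ℝ d}

/-- Slice form of the bound: for a.e. `t ∈ (0,T)`, `‖u(t,x)‖ ≤ U` for a.e. `x`. [cite: DiPernaLions1989, §II.1 (12)–(14)] -/
theorem ae_ae_norm_le (h : DriftBound T u U) :
    ∀ᵐ t ∂((volume : Measure ℝ).restrict (Ioo 0 T)), ∀ᵐ x ∂(volume : Measure (UnitAddTorus d)),
      ‖u t x‖ ≤ U :=
  Measure.ae_ae_of_ae_prod h.ae_norm_le

/-- Slices are a.e. strongly measurable for a.e. `t`. [cite: DiPernaLions1989, §II.1 (12)–(14)] -/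
theorem ae_aestronglyMeasurable_slice (h : DriftBound T u U) :
    ∀ᵐ t ∂((volume : Measure ℝ).restrict (Ioo 0 T)),
      AEStronglyMeasurable (u t) (volume : Measure (UnitAddTorus d)) :=
  h.aestronglyMeasurable.prodMk_left

/-- Components are bounded by the norm bound: `|uⱼ(t,x)| ≤ U` a.e. [cite: DiPernaLions1989, §II.1 (12)–(14)] -/
theorem ae_abs_apply_le (h : DriftBound T u U) (j : d) :
    ∀ᵐ p ∂(((volume : Measure ℝ).restrict (Ioo 0 T)).prod (volume : Measure (UnitAddTorus d))),
      |u p.1 p.2 j| ≤ U := by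
  filter_upwards [h.ae_norm_le] with p hp
  have h1 : ‖u p.1 p.2 j‖ ≤ ‖u p.1 p.2‖ := PiLp.norm_apply_le (u p.1 p.2) j
  rw [Real.norm_eq_abs] at h1
  exact h1.trans hp

/-- **`u ∈ L^∞((0,T) × ℝ^d)` (space–time lift) gives a drift bound.** [cite: DiPernaLions1989, §II.1 (12)–(14)] -/
theorem of_memLp_top (hu : MemLp (stLift u) ∞ (volume.restrict (Ioo 0 T ×ˢ univ))) :
    ∃ U : ℝ, DriftBound T u U := by
  obtain ⟨U, hU0, hU⟩ := ae_norm_le_prod_of_memLp_top_stLift hu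
  exact ⟨U, ⟨hU0, aestronglyMeasurable_uncurry_of_stLift_prod hu.1, hU⟩⟩

end DriftBound

/-- **A field in `L^∞(0,T; L²(T^d))` defined at every time of `[0,T]`** with the bound `E` on
`∫ θ(t)²`: jointly measurable on `(0,T) × T^d`, and for EVERY `t ∈ [0,T]` the slice `θ(t)` is in
`L²` with `∫ θ(t)² ≤ E` (the class in which the Picard iteration runs; its members are evaluated
at every time, as the synthesized fields of `Torus.exists_realScalarField_forall_mFourierCoeff_eq`
are). [cite: DiPernaLions1989, §II.1 (12)–(14)] -/
structure IsL2Field (T E : ℝ) (θ : ℝ → UnitAddTorus d → ℝ) : Prop where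
  /-- Joint measurability on `(0,T) × T^d`. -/
  aestronglyMeasurable :
    AEStronglyMeasurable (uncurry θ) (((volume : Measure ℝ).restrict (Ioo 0 T)).prod volume)
  /-- Every slice on `[0,T]` is square integrable. -/
  memLp : ∀ t ∈ Icc 0 T, MemLp (θ t) 2 (volume : Measure (UnitAddTorus d))
  /-- The uniform `L²` bound on `[0,T]`. -/
  integral_sq_le : ∀ t ∈ Icc 0 T, ∫ x, θ t x ^ 2 ≤ E

namespace IsL2Field

variable {T E : ℝ} {θ θ' : ℝ → UnitAddTorus d → ℝ}

/-- The bound is nonnegative as soon as `[0,T]` is nonempty. [cite: DiPernaLions1989, §II.1 (12)–(14)] -/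
theorem nonneg (h : IsL2Field T E θ) (hT : 0 ≤ T) : 0 ≤ E :=
  (integral_nonneg fun _ => sq_nonneg _).trans (h.integral_sq_le 0 (left_mem_Icc.2 hT))

/-- The zero field. [cite: DiPernaLions1989, §II.1 (12)–(14)] -/
theorem zero (T : ℝ) {E : ℝ} (hE : 0 ≤ E) : IsL2Field T E (fun _ _ => (0 : ℝ) : ℝ → UnitAddTorus d → ℝ) := by
  refine ⟨?_, fun t _ => ?_, fun t _ => ?_⟩
  · exact (aestronglyMeasurable_const (b := (0 : ℝ))).congr (ae_of_all _ fun p => rfl)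
  · exact memLp_const 0
  · simpa using hE

/-- Monotonicity in the bound. [cite: DiPernaLions1989, §II.1 (12)–(14)] -/
theorem mono (h : IsL2Field T E θ) {E' : ℝ} (hE : E ≤ E') : IsL2Field T E' θ :=
  ⟨h.aestronglyMeasurable, h.memLp, fun t ht => (h.integral_sq_le t ht).trans hE⟩

/-- Slicewise `∫⁻ ‖θ(t)‖ₑ² ≤ E` on `[0,T]`. [cite: DiPernaLions1989, §II.1 (12)–(14)] -/
theorem lintegral_sq_le (h : IsL2Field T E θ) {t : ℝ} (ht : t ∈ Icc 0 T) :
    ∫⁻ x, ‖θ t x‖ₑ ^ 2 ≤ ENNReal.ofReal E := by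
  rw [lintegral_enorm_sq_eq_ofReal_sq (h.memLp t ht)]
  exact ENNReal.ofReal_le_ofReal (h.integral_sq_le t ht)

/-- The space–time square integral is finite: `∫_{(0,T)} ∫⁻ ‖θ‖ₑ² ≤ T·E < ∞`. [cite: DiPernaLions1989, §II.1 (12)–(14)] -/
theorem lintegral_lintegral_sq_lt_top (h : IsL2Field T E θ) :
    ∫⁻ t in Ioo 0 T, ∫⁻ x, ‖θ t x‖ₑ ^ 2 < ∞ := by
  have h1 : ∫⁻ t in Ioo 0 T, ∫⁻ x, ‖θ t x‖ₑ ^ 2 ≤ ∫⁻ _ in Ioo 0 T, ENNReal.ofReal E := by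
    refine setLIntegral_mono' measurableSet_Ioo fun t ht => ?_
    exact h.lintegral_sq_le (Ioo_subset_Icc_self ht)
  refine lt_of_le_of_lt h1 ?_
  rw [lintegral_const, Measure.restrict_apply_univ]
  exact ENNReal.mul_lt_top ENNReal.ofReal_lt_top measure_Ioo_lt_top

/-- The field is square integrable on `(0,T) × T^d`. [cite: DiPernaLions1989, §II.1 (12)–(14)] -/
theorem memLp_uncurry (h : IsL2Field T E θ) :
    MemLp (uncurry θ) 2 (((volume : Measure ℝ).restrict (Ioo 0 T)).prod (volume : Measure (UnitAddTorus d))) :=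
  (FunctionSpaces.Torus.memLp_two_uncurry h.aestronglyMeasurable h.lintegral_lintegral_sq_lt_top).1

/-- The field is integrable on `(0,T) × T^d` (finite measure). [cite: DiPernaLions1989, §II.1 (12)–(14)] -/
theorem integrable_uncurry (h : IsL2Field T E θ) :
    Integrable (uncurry θ) (((volume : Measure ℝ).restrict (Ioo 0 T)).prod (volume : Measure (UnitAddTorus d))) := by
  haveI : IsFiniteMeasure ((volume : Measure ℝ).restrict (Ioo 0 T)) :=
    isFiniteMeasure_restrict.2 measure_Ioo_lt_top.ne
  exact h.memLp_uncurry.integrable one_le_two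

/-- Differences of fields. [cite: DiPernaLions1989, §II.1 (12)–(14)] -/
theorem sub (h : IsL2Field T E θ) {E' : ℝ} (h' : IsL2Field T E' θ') {E'' : ℝ}
    (hb : ∀ t ∈ Icc 0 T, ∫ x, (θ t x - θ' t x) ^ 2 ≤ E'') :
    IsL2Field T E'' (fun t x => θ t x - θ' t x) :=
  ⟨h.aestronglyMeasurable.sub h'.aestronglyMeasurable, fun t ht => (h.memLp t ht).sub (h'.memLp t ht), hb⟩

/-- Scaling by a continuous time factor. [cite: DiPernaLions1989, §II.1 (12)–(14)] -/
theorem mul_continuous (h : IsL2Field T E θ) {f : ℝ → ℝ} (hf : Continuous f) {M : ℝ}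
    (hM : ∀ t ∈ Icc 0 T, f t ^ 2 ≤ M) :
    IsL2Field T (M * E) (fun t x => f t * θ t x) := by
  refine ⟨?_, fun t ht => (h.memLp t ht).const_mul (f t), fun t ht => ?_⟩
  · exact ((hf.comp continuous_fst).aestronglyMeasurable).mul h.aestronglyMeasurable
  · have e : ∫ x, (f t * θ t x) ^ 2 = f t ^ 2 * ∫ x, θ t x ^ 2 := by
      rw [← integral_const_mul]
      exact integral_congr_ae (ae_of_all _ fun x => by ring)
    rw [e]
    exact mul_le_mul (hM t ht) (h.integral_sq_le t ht) (integral_nonneg fun _ => sq_nonneg _)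
      ((sq_nonneg _).trans (hM t ht))

end IsL2Field

end Hypotheses

end Torus

end Literature.Analysis.FluidPDE

end
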